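import Summits.QuantumFields.YangMills.Theorems.FluctuationComparisonRegPrIntLS1aCentralEdgeGeometry
import HarnessLib

/-!
# (T⊥) at small fields, index-free: member loops in `d ≥ 3` and central-edge plaquettes without a chosen compensating direction

The fibre-openness letters ✓`FluctuationComparisonRegPrIntLS1aFibreOpenMember.loopHol_fibre_locally_onto` (member loops) and
✓`FluctuationComparisonRegPrIntLS1aCentralEdgeGeometry.plaqHol_fibre_locally_onto'` (central-edge plaquettes) take a compensating direction
`ν ≠ c.dir` as input, and the member version also asks that the member's stair word does not start with the letter `(ν, +)`. This file removes
that choice: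

* §1 `exists_dir_ne_head_ne` — in `d ≥ 3` directions there is, for every direction `D` and every word `w`, a direction `ν ≠ D` with
  `w.head? ≠ some (ν, true)` (two of the `d − 1 ≥ 2` directions `≠ D` cannot both be the head's direction);
* §2 `loopHol_fibre_locally_onto_of_three_le` — the member-loop openness for EVERY non-central index `i` when `3 ≤ d`, with the single
  direction-free numerical side condition `800·ℓ·α < 1/|I|` (§0: `s′(ν) ≥ 1`, ✓`one_le_card_centreLeg`);
* §3 `plaqHol_fibre_locally_onto_of_forall_dir` — the central-edge plaquette openness with no direction input (any `d`; the compensating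
  direction is the plaquette direction other than `c₀.dir`);
* §4 `loopHol_fibre_locally_onto_of_plaqSmall`, `plaqHol_fibre_locally_onto_of_plaqSmall` — the same with the loop bound supplied by
  ✓`LatticeWordStokes.dist1_loopHol_le` (`α := ((d+2)L)²δ₁/4`): hypotheses `PlaqSmall δ₁ U` and three numerical conditions on `δ₁` only.

Bookkeeping over landed theorems; nothing of Bałaban's is formalised here beyond what the imported files cite. This does NOT prove (T⊥)'s
consumers, `FluctuationComparisonRegPrIntL`, or `YM3TorusSU2`; rung R3 = `SU(2)` YM₃ on `T³` only (there `d = 3`).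
-/

set_option autoImplicit false

noncomputable section

open scoped Matrix.Norms.L2Operator Topology
open Filter Function

namespace Summit.QuantumFields.YangMills.Theorems.FluctuationComparisonRegPrIntLS1aFibreOpenIndexFree

open Literature.MathematicalPhysics.QuantumFieldTheory.Balaban1983to89
open T4Continuum AveragingRT BlockAveraging ExpMeanLog BlockAveragingHaarAC
open Summit.QuantumFields.YangMills.Theorems.FluctuationComparisonRegPrIntLS1aCentreLegOccurrence
open Summit.QuantumFields.YangMills.Theorems.FluctuationComparisonRegPrIntLS1aFibreOpenMember
open Summit.QuantumFields.YangMills.Theorems.FluctuationComparisonRegPrIntLS1aFibreOpenPlaquette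
open Summit.QuantumFields.YangMills.Theorems.FluctuationComparisonRegPrIntLS1aCentralEdgeGeometry

variable {P : Params} {j : ℕ}

/-! ## §0 The numerical side condition is uniform in the direction -/

/-- `s′(ν) ≥ 1` (✓`one_le_card_centreLeg`) turns `800·ℓ·α < 1/|I|` into the direction-dependent side condition `800·ℓ·α < s′(ν)/|I|` of the
fibre-openness letters. [folklore] -/
theorem side_condition_of_uniform {α : ℝ} (hD : 800 * (((P.d + 2) * P.L : ℕ) : ℝ) * α < ((Fintype.card (Idx P) : ℝ))⁻¹) (ν : Fin P.d) :
    800 * (((P.d + 2) * P.L : ℕ) : ℝ) * α < ((Fintype.card (Idx P) : ℝ))⁻¹ *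
      ((Finset.univ.filter fun i' : Idx P => (stairWord i'.2.1 (off i'.1)).head? = some (ν, true)).card : ℝ) := by
  classical
  have h1 : (1 : ℝ) ≤ ((Finset.univ.filter fun i' : Idx P => (stairWord i'.2.1 (off i'.1)).head? = some (ν, true)).card : ℝ) := by
    exact_mod_cast one_le_card_centreLeg (P := P) ν
  have h0 : (0 : ℝ) ≤ ((Fintype.card (Idx P) : ℝ))⁻¹ := inv_nonneg.2 (Nat.cast_nonneg _)
  calc 800 * (((P.d + 2) * P.L : ℕ) : ℝ) * α < ((Fintype.card (Idx P) : ℝ))⁻¹ := hD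
    _ = ((Fintype.card (Idx P) : ℝ))⁻¹ * 1 := (mul_one _).symm
    _ ≤ _ := mul_le_mul_of_nonneg_left h1 h0

/-! ## §1 A compensating direction always exists in `d ≥ 3` -/

/-- In `d ≥ 3` directions: for every direction `D` and every word `w` there is a direction `ν ≠ D` such that `w` does not start with the
letter `(ν, +)`. [folklore] -/
theorem exists_dir_ne_head_ne (hd : 3 ≤ P.d) (D : Fin P.d) (w : List (Fin P.d × Bool)) :
    ∃ ν : Fin P.d, ν ≠ D ∧ w.head? ≠ some (ν, true) := by
  classical
  have hS : 1 < (Finset.univ.erase D).card := by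
    rw [Finset.card_erase_of_mem (Finset.mem_univ _), Finset.card_univ, Fintype.card_fin]; omega
  obtain ⟨a, b, ha, hb, hab⟩ := Finset.one_lt_card_iff.1 hS
  have ha' := (Finset.mem_erase.1 ha).1
  have hb' := (Finset.mem_erase.1 hb).1
  cases hw : w.head? with
  | none => exact ⟨a, ha', by simp⟩
  | some l =>
    by_cases hl : l.1 = a
    · refine ⟨b, hb', fun h => hab ?_⟩
      cases h; exact hl.symm
    · refine ⟨a, ha', fun h => hl ?_⟩
      cases h; rfl

/-! ## §2 Member loops: openness along the fibres for every non-central index (`d ≥ 3`) -/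

/-- **MEMBER LOOPS ARE OPEN ALONG THE `(0.4)` FIBRES AT SMALL FIELDS — every non-central index, `d ≥ 3`.**  For `SU(2)`, `3 ≤ d`, small
plaquettes (`PlaqSmall δ₁`, `((d+2)L)²δ₁/4 < δ_SU`), a coarse bond `c`, a NON-central index `i`, the loop bound `α` with `α < 1/24`,
`α < δ_SU/2` and `800·ℓ·α < 1/|I|` (`ℓ = (d+2)L`, `|I| = #Idx`), and every `ε > 0`: all `x` near `W_{c,i}(U)` are attained as `W_{c,i}(U′)` by
fields `U′` `ε`-close to `U` bondwise with the same block averages.  (✓`loopHol_fibre_locally_onto` at the direction of §1.)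
[cite: Balaban1987RG1, (0.4) p.253; folklore] -/
theorem loopHol_fibre_locally_onto_of_three_le (hd : 3 ≤ P.d) (hj : j + 1 ≤ P.m + P.K) {δ₁ : ℝ} (hδ : 0 ≤ δ₁)
    (hτ : ((((P.d + 2) * P.L : ℕ) : ℝ) ^ 2 / 4) * δ₁ < deltaSU (Fin 2))
    (U : GaugeField P j (Matrix.specialUnitaryGroup (Fin 2) ℂ)) (hU : PlaqSmall δ₁ U)
    (c : PBond P (j + 1)) (i : Idx P) (hic : ¬ IsCentral c i)
    {α : ℝ} (hα : ∀ i', dist1 (loopHol U c i') ≤ α)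
    (hA : α < 1 / 24) (hC : α < deltaSU (Fin 2) / 2)
    (hD : 800 * (((P.d + 2) * P.L : ℕ) : ℝ) * α < ((Fintype.card (Idx P) : ℝ))⁻¹)
    {ε : ℝ} (hε : 0 < ε) :
    ∃ η : ℝ, 0 < η ∧ ∀ x : Matrix.specialUnitaryGroup (Fin 2) ℂ,
      ‖(x : Matrix (Fin 2) (Fin 2) ℂ) - ((loopHol U c i : Matrix.specialUnitaryGroup (Fin 2) ℂ) : Matrix (Fin 2) (Fin 2) ℂ)‖ < η →
        ∃ U' : GaugeField P j (Matrix.specialUnitaryGroup (Fin 2) ℂ),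
          (∀ b, ‖((U' b : Matrix.specialUnitaryGroup (Fin 2) ℂ) : Matrix (Fin 2) (Fin 2) ℂ) - (U b : Matrix (Fin 2) (Fin 2) ℂ)‖ < ε) ∧
          avgFun (expMeanLogSU (n := Fin 2)) U' = avgFun (expMeanLogSU (n := Fin 2)) U ∧ loopHol U' c i = x := by
  classical
  obtain ⟨ν, hν, hiS⟩ := exists_dir_ne_head_ne hd c.dir (stairWord i.2.1 (off i.1))
  exact loopHol_fibre_locally_onto hj hδ hτ U hU c hν i hic hiS hα _ rfl hA hC (side_condition_of_uniform hD ν) hε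

/-! ## §3 Central-edge plaquettes: openness along the fibres with no direction input -/

/-- **CENTRAL-EDGE PLAQUETTES ARE OPEN ALONG THE `(0.4)` FIBRES AT SMALL FIELDS — no direction input.**  For `SU(2)`, small plaquettes, a
plaquette `p` with the central crossing bond `β(c₀)` among its edges, the loop bound `α` with `α < 1/24`, `α < δ_SU/2` and
`800·ℓ·α < 1/|I|`, and every `ε > 0`: all `x` with `x·U(∂p)⁻¹` near `1` are attained as `U′(∂p)` by fields `U′`
`ε`-close to `U` bondwise with the same block averages.  (✓`plaqHol_fibre_locally_onto'` at the plaquette direction other than `c₀.dir`.)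
[cite: Balaban1987RG1, (0.4) p.253; folklore] -/
theorem plaqHol_fibre_locally_onto_of_forall_dir (hj : j + 1 ≤ P.m + P.K) {δ₁ : ℝ} (hδ : 0 ≤ δ₁)
    (hτ : ((((P.d + 2) * P.L : ℕ) : ℝ) ^ 2 / 4) * δ₁ < deltaSU (Fin 2))
    (U : GaugeField P j (Matrix.specialUnitaryGroup (Fin 2) ℂ)) (hU : PlaqSmall δ₁ U)
    (c₀ : PBond P (j + 1)) (p : Plaq P j)
    (hβ : centralBond c₀ = ⟨p.src, p.μ⟩ ∨ centralBond c₀ = ⟨p.src.shift p.μ, p.ν⟩ ∨ centralBond c₀ = ⟨p.src.shift p.ν, p.μ⟩ ∨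
      centralBond c₀ = ⟨p.src, p.ν⟩)
    {α : ℝ} (hα : ∀ i', dist1 (loopHol U c₀ i') ≤ α)
    (hA : α < 1 / 24) (hC : α < deltaSU (Fin 2) / 2)
    (hD : 800 * (((P.d + 2) * P.L : ℕ) : ℝ) * α < ((Fintype.card (Idx P) : ℝ))⁻¹)
    {ε : ℝ} (hε : 0 < ε) :
    ∃ η : ℝ, 0 < η ∧ ∀ x : Matrix.specialUnitaryGroup (Fin 2) ℂ,
      dist1 (x * (GaugeField.plaqHol U p)⁻¹) < η →
        ∃ U' : GaugeField P j (Matrix.specialUnitaryGroup (Fin 2) ℂ),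
          (∀ b, ‖((U' b : Matrix.specialUnitaryGroup (Fin 2) ℂ) : Matrix (Fin 2) (Fin 2) ℂ) - (U b : Matrix (Fin 2) (Fin 2) ℂ)‖ < ε) ∧
          avgFun (expMeanLogSU (n := Fin 2)) U' = avgFun (expMeanLogSU (n := Fin 2)) U ∧ GaugeField.plaqHol U' p = x := by
  classical
  have hμν : p.μ ≠ p.ν := ne_of_lt p.hμν
  -- the plaquette direction other than `c₀.dir`
  by_cases h : c₀.dir = p.μ
  · exact plaqHol_fibre_locally_onto' hj hδ hτ U hU c₀ (ν := p.ν) (fun h' => hμν (h'.trans h).symm) p hβ hα _ rfl hA hC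
      (side_condition_of_uniform hD p.ν) hε
  · exact plaqHol_fibre_locally_onto' hj hδ hτ U hU c₀ (ν := p.μ) (fun h' => h h'.symm) p hβ hα _ rfl hA hC
      (side_condition_of_uniform hD p.μ) hε

/-! ## §4 The `PlaqSmall`-only forms -/

/-- **MEMBER LOOPS ARE OPEN ALONG THE `(0.4)` FIBRES — `PlaqSmall` only (`d ≥ 3`).**  With the loop bound `α := ((d+2)L)²δ₁/4` of
✓`LatticeWordStokes.dist1_loopHol_le`, the member-loop openness holds for EVERY `δ₁`-small `SU(2)` field, every coarse bond and every non-central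
index, under three numerical conditions on `δ₁` alone: `((d+2)L)²δ₁/4 < 1/24`, `< δ_SU/2`, and `800·(d+2)L·((d+2)L)²δ₁/4 < 1/|I|`.
[cite: Balaban1987RG1, (0.4) p.253; folklore] -/
theorem loopHol_fibre_locally_onto_of_plaqSmall (hd : 3 ≤ P.d) (hj : j + 1 ≤ P.m + P.K) {δ₁ : ℝ} (hδ : 0 ≤ δ₁)
    (hA : ((((P.d + 2) * P.L : ℕ) : ℝ) ^ 2 / 4) * δ₁ < 1 / 24)
    (hC : ((((P.d + 2) * P.L : ℕ) : ℝ) ^ 2 / 4) * δ₁ < deltaSU (Fin 2) / 2)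
    (hD : 800 * (((P.d + 2) * P.L : ℕ) : ℝ) * (((((P.d + 2) * P.L : ℕ) : ℝ) ^ 2 / 4) * δ₁) < ((Fintype.card (Idx P) : ℝ))⁻¹)
    (U : GaugeField P j (Matrix.specialUnitaryGroup (Fin 2) ℂ)) (hU : PlaqSmall δ₁ U)
    (c : PBond P (j + 1)) (i : Idx P) (hic : ¬ IsCentral c i) {ε : ℝ} (hε : 0 < ε) :
    ∃ η : ℝ, 0 < η ∧ ∀ x : Matrix.specialUnitaryGroup (Fin 2) ℂ,
      ‖(x : Matrix (Fin 2) (Fin 2) ℂ) - ((loopHol U c i : Matrix.specialUnitaryGroup (Fin 2) ℂ) : Matrix (Fin 2) (Fin 2) ℂ)‖ < η →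
        ∃ U' : GaugeField P j (Matrix.specialUnitaryGroup (Fin 2) ℂ),
          (∀ b, ‖((U' b : Matrix.specialUnitaryGroup (Fin 2) ℂ) : Matrix (Fin 2) (Fin 2) ℂ) - (U b : Matrix (Fin 2) (Fin 2) ℂ)‖ < ε) ∧
          avgFun (expMeanLogSU (n := Fin 2)) U' = avgFun (expMeanLogSU (n := Fin 2)) U ∧ loopHol U' c i = x :=
  have hτ : ((((P.d + 2) * P.L : ℕ) : ℝ) ^ 2 / 4) * δ₁ < deltaSU (Fin 2) :=
    hC.trans_le (by linarith [deltaSU_pos (n := Fin 2)])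
  loopHol_fibre_locally_onto_of_three_le hd hj hδ hτ U hU c i hic (fun i' => LatticeWordStokes.dist1_loopHol_le hδ hU c i') hA hC hD hε

/-- **CENTRAL-EDGE PLAQUETTES ARE OPEN ALONG THE `(0.4)` FIBRES — `PlaqSmall` only (any `d`).**  As above for the holonomy of a plaquette
having the central crossing bond `β(c₀)` among its edges. [cite: Balaban1987RG1, (0.4) p.253; folklore] -/
theorem plaqHol_fibre_locally_onto_of_plaqSmall (hj : j + 1 ≤ P.m + P.K) {δ₁ : ℝ} (hδ : 0 ≤ δ₁)
    (hA : ((((P.d + 2) * P.L : ℕ) : ℝ) ^ 2 / 4) * δ₁ < 1 / 24)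
    (hC : ((((P.d + 2) * P.L : ℕ) : ℝ) ^ 2 / 4) * δ₁ < deltaSU (Fin 2) / 2)
    (hD : 800 * (((P.d + 2) * P.L : ℕ) : ℝ) * (((((P.d + 2) * P.L : ℕ) : ℝ) ^ 2 / 4) * δ₁) < ((Fintype.card (Idx P) : ℝ))⁻¹)
    (U : GaugeField P j (Matrix.specialUnitaryGroup (Fin 2) ℂ)) (hU : PlaqSmall δ₁ U)
    (c₀ : PBond P (j + 1)) (p : Plaq P j)
    (hβ : centralBond c₀ = ⟨p.src, p.μ⟩ ∨ centralBond c₀ = ⟨p.src.shift p.μ, p.ν⟩ ∨ centralBond c₀ = ⟨p.src.shift p.ν, p.μ⟩ ∨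
      centralBond c₀ = ⟨p.src, p.ν⟩) {ε : ℝ} (hε : 0 < ε) :
    ∃ η : ℝ, 0 < η ∧ ∀ x : Matrix.specialUnitaryGroup (Fin 2) ℂ,
      dist1 (x * (GaugeField.plaqHol U p)⁻¹) < η →
        ∃ U' : GaugeField P j (Matrix.specialUnitaryGroup (Fin 2) ℂ),
          (∀ b, ‖((U' b : Matrix.specialUnitaryGroup (Fin 2) ℂ) : Matrix (Fin 2) (Fin 2) ℂ) - (U b : Matrix (Fin 2) (Fin 2) ℂ)‖ < ε) ∧
          avgFun (expMeanLogSU (n := Fin 2)) U' = avgFun (expMeanLogSU (n := Fin 2)) U ∧ GaugeField.plaqHol U' p = x :=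
  have hτ : ((((P.d + 2) * P.L : ℕ) : ℝ) ^ 2 / 4) * δ₁ < deltaSU (Fin 2) :=
    hC.trans_le (by linarith [deltaSU_pos (n := Fin 2)])
  plaqHol_fibre_locally_onto_of_forall_dir hj hδ hτ U hU c₀ p hβ (fun i' => LatticeWordStokes.dist1_loopHol_le hδ hU c₀ i') hA hC hD hε

end Summit.QuantumFields.YangMills.Theorems.FluctuationComparisonRegPrIntLS1aFibreOpenIndexFree

end
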